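import Literature.Barriers.PneNP.TSPExtensionComplexityPMPolytope
import Literature.Combinatorics.Optimization.SymmetricSDPMatching
import HarnessLib

/-!
# Equivariant psd factorizations of the perfect-matching slack matrix (Fawzi–Saunderson–Parrilo)

Vocabulary only (definitions, no facts asserted). Fawzi–Saunderson–Parrilo's `G`-EQUIVARIANT PSD LIFT
[cite: FawziSaundersonParrilo2013, Def. 2 (p. 3)] read AT FACTORIZATION LEVEL through their factorization
theorem [cite: FawziSaundersonParrilo2013, Thm. 4 (p. 10)] — psd-valued maps `A` on the points, `B` on the
linear functionals, the slack identity, and `A(g·x) = ρ(g) A(x) ρ(g)ᵀ` for a homomorphism `ρ : G → GL_d(ℝ)` —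
specialised to `G = S_n` acting on the perfect matchings of `K_n` and to the odd-cut slacks
`|δ(U) ∩ M| − 1` of Edmonds' perfect matching polytope [cite: BraunEtAl2016, §4.1 (p. 8)]. Coordinate-symmetric
SDPs/factorizations [cite: BraunEtAl2016, Def. 2.2 (p. 5)] are the special case in which every `ρ(σ)` is a
permutation matrix [cite: FawziSaundersonParrilo2013, §1 (p. 4)]. Also the notion of an `S_n`-INVARIANT SUBSPACE
of real functions on perfect matchings [cite: FawziSaundersonParrilo2013, Thm. 1 (p. 7)] (over
`Literature.Combinatorics.Optimization.PMSol n` and its `Equiv.Perm (Fin n)`-action).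

Typed verbatim as in cell pnp-psdrank's kernel-checked sketch (pnp-psdrank-p2 `Sketch-v3-imports.lean` §3–4;
referee PASS 2026-08-25); consumers: the rung leaf `Summit.PneNP.MatchingPsdRank.MatchingEquivariantPsdBound`
and the items of its D-0059 route. ONLY `A`-SIDE EQUIVARIANCE is part of the definition (the odd-set factor
`B` is unconstrained) — a deliberate strength of the hypothesis class; do not "symmetrize" it.
-/

noncomputable section

open Finset Matrix

namespace Literature.Combinatorics.Optimization

open Literature.Barriers.PneNP

/-- The odd-cut slack `S_{U,M} = |δ(U) ∩ M| − 1` of a vertex set `U` against an edge set `M` (raw-finset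
form of `Literature.Barriers.PneNP.pmOddCutSlack`). [cite: BraunEtAl2016, §4.1 (p. 8)] -/
def pmSlack {n : ℕ} (U : Finset (Fin n)) (M : Finset (Sym2 (Fin n))) : ℝ :=
  ((M.filter fun e => cutCount U e = 1).card : ℝ) - 1

/-- Vertex permutations act on edge sets: `σ·M = {σ(e) : e ∈ M}` (`= (σ • M).1` for `M : PMSol n`,
cf. `PMSol.smul_val`). [cite: BraunEtAl2016, §4.1 (p. 8)] -/
def permEdges {n : ℕ} (σ : Equiv.Perm (Fin n)) (M : Finset (Sym2 (Fin n))) : Finset (Sym2 (Fin n)) :=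
  M.image (Sym2.map σ)

/-- `(ρ, A, B)` is an **`S_n`-equivariant psd factorization of size `d`** of the odd-cut slack matrix of the
perfect matching polytope of `K_n`: `A(M) ⪰ 0` on perfect matchings, `B(U) ⪰ 0` on odd vertex sets,
`|δ(U) ∩ M| − 1 = tr(A(M) B(U))`, and `A(σ·M) = ρ(σ) A(M) ρ(σ)ᵀ` for a group homomorphism
`ρ : S_n → GL_d(ℝ)` (an arbitrary real representation). Only `A`-side equivariance is assumed.
[cite: FawziSaundersonParrilo2013, Def. 2 (p. 3)] [cite: FawziSaundersonParrilo2013, Thm. 4 (p. 10)] -/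
def IsEquivariantPsdFactorization (n d : ℕ) (ρ : Equiv.Perm (Fin n) →* GL (Fin d) ℝ)
    (A : Finset (Sym2 (Fin n)) → Matrix (Fin d) (Fin d) ℝ)
    (B : Finset (Fin n) → Matrix (Fin d) (Fin d) ℝ) : Prop :=
  (∀ M, IsPMOn univ M → (A M).PosSemidef) ∧
  (∀ U, Odd U.card → (B U).PosSemidef) ∧
  (∀ U M, Odd U.card → IsPMOn univ M → pmSlack U M = (A M * B U).trace) ∧
  (∀ σ M, IsPMOn univ M →
    A (permEdges σ M) = (ρ σ : Matrix (Fin d) (Fin d) ℝ) * A M * (ρ σ : Matrix (Fin d) (Fin d) ℝ)ᵀ)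

/-- The odd-cut slack matrix of `P_PM(n)` **has** an `S_n`-equivariant psd factorization of size `d`.
[cite: FawziSaundersonParrilo2013, Def. 2 (p. 3)] -/
def HasEquivariantPsdFactorization (n d : ℕ) : Prop :=
  ∃ (ρ : Equiv.Perm (Fin n) →* GL (Fin d) ℝ) (A : Finset (Sym2 (Fin n)) → Matrix (Fin d) (Fin d) ℝ)
    (B : Finset (Fin n) → Matrix (Fin d) (Fin d) ℝ), IsEquivariantPsdFactorization n d ρ A B

/-- A subspace `V` of real functions on the perfect matchings of `K_n` is **`S_n`-invariant**:
`(σ·f)(M) = f(σ⁻¹·M)` stays in `V`. [cite: FawziSaundersonParrilo2013, Thm. 1 (p. 7)] -/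
def IsPermInvariant {n : ℕ} (V : Submodule ℝ (PMSol n → ℝ)) : Prop :=
  ∀ σ : Equiv.Perm (Fin n), ∀ f ∈ V, (fun M => f (σ⁻¹ • M)) ∈ V

end Literature.Combinatorics.Optimization

end
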